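import Summits.QuantumFields.YangMills.Theorems.UnitScaleTiltProp7LocMinOfGaugedRows116
import HarnessLib

/-!
# Route `UnitScaleTilt`, crux K1 child «MinimiserStabilityRegPr» (stmt-QuantumFields-19200) — THE E′ TEXT OF RECORD FROM THE UNTWISTED-FIBRE ROWS WITH `L`-ONLY CONSTANTS:
# E′ ⇐ ∀ members, per competitor {CHART `s₀ℓ⁻¹`, `e^{iD}W ∈ 𝔅_k(V)`, SLICE `DIV ≤ ζK + δ₀ℓ⁻²M`, JOINT MOD COARSE GAUGE `≤ C₁ℓ⁻¹M + C₂ℓ(K + DIV)`} (HESS by ✓`hessW_curl_div_of_mem_fibre_T3`)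

Cell `ym3-torus` ∕ fleet seat `ym-ust-19200-p1` (gen 14, route-R lead ∕ (n3) namer).  THEOREMS ONLY (0 `def`, 0 `sorry`); `--supports stmt-QuantumFields-19200`, count-neutral.
YM₃ on T³ is a ladder rung (R3), not the Clay problem; nothing here claims the stub, the crux, d = 4 or the mass gap; E′ is NOT closed by this file.

WHY.  ✓`Prop7LocMinOfGaugedRows116.isMinOn_regFibrePr_of_fibreRows_at` is the growth-side door at ONE datum with HESS_W′ discharged on the untwisted (0.4)-fibre; this file is
its E′-TEXT reading (the pattern of ✓`Prop7LocMinOfMultiplierRows.stub_PV3E_of_multiplierRows` ∕ ✓`Prop7LocMinOfGaugedRows.stub_PV3E_of_gaugedRows`): ONE displayed uniform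
hypothesis `hrowsU` with `L`-only constants `e₆, s₀, ζ, δ₀, C₁, C₂` — radius `s = s₀ℓ⁻¹`, slice budget `δ = δ₀ℓ⁻²`, `κ = κ_Hℓ⁻²` with `κ_H = 1∕(128(18 + 537600L⁴))` fixed by the
HESS theorem — and the windows `10¹⁴L⁹e₆ ≤ 1`, `4s₀ ≤ 1`, `4·10¹¹L⁹s₀ ≤ 1`, `16e₆C₂(1+ζ) ≤ 1`, `15552s₀² + 216e₆ + 2e₆(C₁ + C₂δ₀) ≤ ((κ_H − δ₀∕4)∕(1 + ζ∕4))∕8`; every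
`ℓ`-power cancels (`scaled` step in the proof).  CONCLUSION = the E′ text verbatim (`e₅ := e₆`, `a₁'' := 1`).

WHAT IS PROVED (ns `…Theorems.Prop7LocMinOfGaugedRows116Text`): ★★★ `stub_PV3E_of_fibreRows`.
HONEST SCOPE.  Bookkeeping.  DISPLAYED per competitor, not proved: the chart with the UNTWISTED membership `e^{iD}W ∈ 𝔅_k(V)` (NOT supplied by the Σ-twisted Thm-2 socket of
record — bus 2026-08-28 15:39Z∕15:58Z), the SLICE divergence budget, and the JOINT row mod coarse gauge in `(K + DIV)` currency (F5 `…JointRowOfSuppliers`, ★w4-19200, in flight).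

References: T. Bałaban, CMP 102 (1985) 277–309 [Balaban1985Variational] ((4)–(7) p.278, (14) p.280, (47)–(48) pp.285–286, (116) p.295, (141)–(143), Prop. 7 p.299);
CMP 99 (1985) 389–434 [Balaban1985BackgroundPropagators] ((3.9)–(3.11) p.392, Thm 3.11 p.416); CMP 99 (1985) 75–102 [Balaban1985RegularSpaces] ((1.38) p.82, Thm 2 p.83).
-/

set_option autoImplicit false
noncomputable section

open scoped BigOperators Matrix.Norms.L2Operator Matrix Topology
open Filter

namespace Summit.QuantumFields.YangMills.Theorems.Prop7LocMinOfGaugedRows116Text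

open Literature.MathematicalPhysics.QuantumFieldTheory.Balaban1983to89
open Literature.MathematicalPhysics.QuantumFieldTheory.Balaban1983to89.T3ContinuumYM3Torus
open Literature.MathematicalPhysics.QuantumFieldTheory.Balaban1983to89.T3UnitLawDensityEML (ℰp)
open Literature.MathematicalPhysics.QuantumFieldTheory.Balaban1983to89.T3ConstrainedMinimiser
open Literature.MathematicalPhysics.QuantumFieldTheory.Balaban1983to89.T3Thm1Carrier
open Literature.MathematicalPhysics.QuantumFieldTheory.Balaban1983to89.T3PrintedRegularMinimiser
open Literature.MathematicalPhysics.QuantumFieldTheory.Balaban1983to89.T3RegularMinimiser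
open Literature.MathematicalPhysics.QuantumFieldTheory.Balaban1983to89.T3Thm1CarrierNative (IsCritR2)
open Literature.MathematicalPhysics.QuantumFieldTheory.Balaban1983to89.T3SectALandauChart (emb15 CloseAvg pos_of_regPr)
open T4Continuum BlockAveraging AveragingRT ExpMeanLog BlockAveragingEMLLinearised BlockAveragingEMLLinearisedBackground BlockAveragingEMLProp2
open Summit.QuantumFields.YangMills.Theorems.Prop7TPrint (expHermField)
open Summit.QuantumFields.YangMills.Theorems.Prop7LocMinOfJointRow (isMinOn_regFibrePr_of_linRows_at linRow_of_QRows)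
open Summit.QuantumFields.YangMills.Theorems.Prop7FirstVariationExactPairing (abs_lin_le_sum_norm_trueLinIter tower_loop_rows_of_regPr gaugeDir_mem_su2)
open Summit.QuantumFields.YangMills.Theorems.Prop7CurvedLandauRowA (exists_trueLinIter_family)
open Summit.QuantumFields.YangMills.Theorems.Prop7LocMinOfMultiplierRows (I_smul_mem_skewAdjoint trace_I_smul_eq_zero scaled_smallness_mult)
open Summit.QuantumFields.YangMills.Theorems.Prop7TrueLinPureGaugeIter (trueLinIter_sub trueLinIter_pureGauge)
open Summit.QuantumFields.YangMills.Theorems.Prop7LinGaugeInvariance (lin_sub_gaugeDir_eq)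
open Summit.QuantumFields.YangMills.Theorems.Prop7LocMinOfGaugedRows (abs_lin_le_sum_norm_trueLinIter_sub_coarseGauge)
open Summit.QuantumFields.YangMills.Theorems.Prop7HessWOfFibreCoreT3 (hessW_curl_div_of_mem_fibre_T3)
open Summit.QuantumFields.YangMills.Theorems.Prop7LocMinOfGaugedRows116 (isMinOn_regFibrePr_of_fibreRows_at)
open B9Eq39Adjoint (divB)
open B9TorusCalculus (torusT)
open B10Eq27TorusAxialLog (unitsField toUField)
open B15DeterminingSets (embIter)
open B5Eq118OneStroke (iterBlockOf)
open Node00 (iterBlockOf_embIter_eq)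

/-! ## The E′ text of record from the untwisted-fibre rows -/

set_option maxHeartbeats 400000 in
/-- ★★★ **ROW E′ ([Balaban1985Variational] (141)–(142) in print's regime) FROM THE UNTWISTED-FIBRE ROWS IN THEIR NATURAL SCALINGS.**  For every `L > 1` constants
`e₆ > 0` (`10¹⁴L⁹e₆ ≤ 1`), `s₀ ≥ 0` (`4s₀ ≤ 1`, `4·10¹¹L⁹s₀ ≤ 1`), `ζ, δ₀, C₁, C₂ ≥ 0` (`16e₆C₂(1+ζ) ≤ 1`, `15552s₀² + 216e₆ + 2e₆(C₁ + C₂δ₀) ≤ ((κ_H − δ₀∕4)∕(1+ζ∕4))∕8`,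
`κ_H = 1∕(128(18 + 537600L⁴))`) such that at every member, radius `0 < e ≤ e₆`, datum `V`, R2-critical `W ∈ (6)(e) ∩ 𝔅_k(V)` and recursion family `Q` at `W`, every competitor
`W′ ∈ (6)(e) ∩ 𝔅_k(V)` has a Hermitian-traceless `D` with `‖D b‖ ≤ s₀ℓ⁻¹`, `A(W′) = A(e^{iD}W)`, `e^{iD}W ∈ 𝔅_k(V)` (UNTWISTED), the SLICE budget `DIV ≤ ζK + δ₀ℓ⁻²M` and the
JOINT row mod coarse gauge `≤ C₁ℓ⁻¹M + C₂ℓ(K + DIV)`.  CONCLUSION = the E′ text verbatim (`e₅ := e₆`, `a₁'' := 1`); HESS_W′ is the theorem ✓`hessW_curl_div_of_mem_fibre_T3` inside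
✓`isMinOn_regFibrePr_of_fibreRows_at`.
[cite: Balaban1985Variational, (141)-(143) p.299, Prop. 7 p.299, (4)-(7) p.278, (14) p.280, (47)-(48) pp.285-286, (116) p.295; Balaban1985BackgroundPropagators, Thm 3.11 p.416] -/
theorem stub_PV3E_of_fibreRows
    (hrowsU : ∀ (L : ℕ), 1 < L → ∃ e₆ s₀ ζ δ₀ C₁ C₂ : ℝ, 0 < e₆ ∧ 100000000000000 * (L : ℝ) ^ 9 * e₆ ≤ 1 ∧ 0 ≤ s₀ ∧ 4 * s₀ ≤ 1 ∧
      400000000000 * (L : ℝ) ^ 9 * s₀ ≤ 1 ∧ 0 ≤ ζ ∧ 0 ≤ δ₀ ∧ 0 ≤ C₁ ∧ 0 ≤ C₂ ∧ 16 * e₆ * (C₂ * (1 + ζ)) ≤ 1 ∧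
      15552 * s₀ ^ 2 + 216 * e₆ + 2 * e₆ * (C₁ + C₂ * δ₀) ≤ (((1 / (128 * (18 + 537600 * (L : ℝ) ^ 4))) - δ₀ / 4) / (1 + ζ / 4)) / 8 ∧
      ∀ (F : T3Family), F.L = L → ∀ (n K : ℕ) (hnK : n < K) (e : ℝ) (V : GaugeField (F.P n) 0 (Matrix.specialUnitaryGroup (Fin 2) ℂ))
        (W : GaugeField (F.P K) 0 (Matrix.specialUnitaryGroup (Fin 2) ℂ)),
        0 < e → e ≤ e₆ → W ∈ regFibrePr F n K hnK.le e V → IsCritR2 F n K hnK.le V W →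
        ∀ (Q : (k : ℕ) → (PBond (F.P K) 0 → Matrix (Fin 2) (Fin 2) ℂ) → PBond (F.P K) k → Matrix (Fin 2) (Fin 2) ℂ), (∀ Y, Q 0 Y = Y) →
        (∀ (k : ℕ) (Y : PBond (F.P K) 0 → Matrix (Fin 2) (Fin 2) ℂ) (c : PBond (F.P K) (k + 1)), Q (k + 1) Y c
          = fderiv ℂ (eml : (Idx (F.P K) → Matrix (Fin 2) (Fin 2) ℂ) → Matrix (Fin 2) (Fin 2) ℂ)
              (fun i => ((loopHol (Averaging.iter (fun i => blockAvg (P := F.P K) (j := i) (expMeanLogSU (n := Fin 2))) k W) c i :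
                Matrix.specialUnitaryGroup (Fin 2) ℂ) : Matrix (Fin 2) (Fin 2) ℂ))
              (fun i => covWalkSum (Averaging.iter (fun i => blockAvg (P := F.P K) (j := i) (expMeanLogSU (n := Fin 2))) k W) (Q k Y)
                  (walk (emb c.src) (loopWord (F.P K).L c.dir (off i.1) i.2.1 i.2.2))
                * ((loopHol (Averaging.iter (fun i => blockAvg (P := F.P K) (j := i) (expMeanLogSU (n := Fin 2))) k W) c i :
                  Matrix.specialUnitaryGroup (Fin 2) ℂ) : Matrix (Fin 2) (Fin 2) ℂ))
              * star ((corr (expMeanLogSU (n := Fin 2)) (Averaging.iter (fun i => blockAvg (P := F.P K) (j := i) (expMeanLogSU (n := Fin 2))) k W) c :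
                  Matrix.specialUnitaryGroup (Fin 2) ℂ) : Matrix (Fin 2) (Fin 2) ℂ)
            + ((corr (expMeanLogSU (n := Fin 2)) (Averaging.iter (fun i => blockAvg (P := F.P K) (j := i) (expMeanLogSU (n := Fin 2))) k W) c :
                  Matrix.specialUnitaryGroup (Fin 2) ℂ) : Matrix (Fin 2) (Fin 2) ℂ)
              * covWalkSum (Averaging.iter (fun i => blockAvg (P := F.P K) (j := i) (expMeanLogSU (n := Fin 2))) k W) (Q k Y)
                  (walk (emb c.src) (List.replicate (F.P K).L (c.dir, true)))
              * star ((corr (expMeanLogSU (n := Fin 2)) (Averaging.iter (fun i => blockAvg (P := F.P K) (j := i) (expMeanLogSU (n := Fin 2))) k W) c :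
                  Matrix.specialUnitaryGroup (Fin 2) ℂ) : Matrix (Fin 2) (Fin 2) ℂ)) →
        ∀ W' : GaugeField (F.P K) 0 (Matrix.specialUnitaryGroup (Fin 2) ℂ), W' ∈ regFibrePr F n K hnK.le e V →
          ∃ (D : PBond (F.P K) 0 → Matrix (Fin 2) (Fin 2) ℂ),
            (∀ b : PBond (F.P K) 0, (D b).IsHermitian ∧ Matrix.trace (D b) = 0) ∧ (∀ b : PBond (F.P K) 0, ‖D b‖ ≤ s₀ * ((F.L : ℝ) ^ (K - n))⁻¹) ∧
            wilsonAction4 W' = wilsonAction4 (emb15 W (expHermField D)) ∧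
            emb15 W (expHermField D) ∈ fibre F ℰp n K hnK.le V ∧
            (∑ x : Site (F.P K) 0, ∑ j : Fin 2, ∑ k : Fin 2,
            ‖(divB (torusT (F.P K) 0) (fun κ z => unitsField (toUField W) ⟨z, κ⟩) (fun κ z => Complex.I • D ⟨z, κ⟩) x) j k‖ ^ 2)
              ≤ ζ * (∑ p : Plaq (F.P K) 0, ‖((Complex.I • D ⟨p.src, p.μ⟩) + ((W ⟨p.src, p.μ⟩ : Matrix (Fin 2) (Fin 2) ℂ) * (Complex.I • D ⟨p.src.shift p.μ, p.ν⟩) * star (W ⟨p.src, p.μ⟩ : Matrix (Fin 2) (Fin 2) ℂ))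
            - (((W ⟨p.src, p.μ⟩ * W ⟨p.src.shift p.μ, p.ν⟩ * (W ⟨p.src.shift p.ν, p.μ⟩)⁻¹ : Matrix.specialUnitaryGroup (Fin 2) ℂ) : Matrix (Fin 2) (Fin 2) ℂ) * (Complex.I • D ⟨p.src.shift p.ν, p.μ⟩) * star ((W ⟨p.src, p.μ⟩ * W ⟨p.src.shift p.μ, p.ν⟩ * (W ⟨p.src.shift p.ν, p.μ⟩)⁻¹ : Matrix.specialUnitaryGroup (Fin 2) ℂ) : Matrix (Fin 2) (Fin 2) ℂ))
            - (((GaugeField.plaqHol W p : Matrix.specialUnitaryGroup (Fin 2) ℂ) : Matrix (Fin 2) (Fin 2) ℂ) * (Complex.I • D ⟨p.src, p.ν⟩) * star ((GaugeField.plaqHol W p : Matrix.specialUnitaryGroup (Fin 2) ℂ) : Matrix (Fin 2) (Fin 2) ℂ)))‖ ^ 2)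
                + δ₀ * (((F.L : ℝ) ^ (K - n)) ^ 2)⁻¹ * ∑ b : PBond (F.P K) 0, ‖D b‖ ^ 2 ∧
            ∃ μ : Site (F.P K) (K - n) → Matrix (Fin 2) (Fin 2) ℂ, (∀ y, μ y ∈ skewAdjoint (Matrix (Fin 2) (Fin 2) ℂ) ∧ (μ y).trace = 0) ∧
            ∑ c : PBond (F.P K) (K - n), ‖Q (K - n) (fun b => Complex.I • D b) c
                - (μ c.src
                  - ((Averaging.iter (fun i => blockAvg (P := F.P K) (j := i) (expMeanLogSU (n := Fin 2))) (K - n) W c : Matrix.specialUnitaryGroup (Fin 2) ℂ) :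
                      Matrix (Fin 2) (Fin 2) ℂ) * μ c.tgt
                    * star ((Averaging.iter (fun i => blockAvg (P := F.P K) (j := i) (expMeanLogSU (n := Fin 2))) (K - n) W c : Matrix.specialUnitaryGroup (Fin 2) ℂ) :
                      Matrix (Fin 2) (Fin 2) ℂ))‖
              ≤ C₁ * ((F.L : ℝ) ^ (K - n))⁻¹ * ∑ b : PBond (F.P K) 0, ‖D b‖ ^ 2
                + C₂ * (F.L : ℝ) ^ (K - n) * ((∑ p : Plaq (F.P K) 0, ‖((Complex.I • D ⟨p.src, p.μ⟩) + ((W ⟨p.src, p.μ⟩ : Matrix (Fin 2) (Fin 2) ℂ) * (Complex.I • D ⟨p.src.shift p.μ, p.ν⟩) * star (W ⟨p.src, p.μ⟩ : Matrix (Fin 2) (Fin 2) ℂ))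
            - (((W ⟨p.src, p.μ⟩ * W ⟨p.src.shift p.μ, p.ν⟩ * (W ⟨p.src.shift p.ν, p.μ⟩)⁻¹ : Matrix.specialUnitaryGroup (Fin 2) ℂ) : Matrix (Fin 2) (Fin 2) ℂ) * (Complex.I • D ⟨p.src.shift p.ν, p.μ⟩) * star ((W ⟨p.src, p.μ⟩ * W ⟨p.src.shift p.μ, p.ν⟩ * (W ⟨p.src.shift p.ν, p.μ⟩)⁻¹ : Matrix.specialUnitaryGroup (Fin 2) ℂ) : Matrix (Fin 2) (Fin 2) ℂ))
            - (((GaugeField.plaqHol W p : Matrix.specialUnitaryGroup (Fin 2) ℂ) : Matrix (Fin 2) (Fin 2) ℂ) * (Complex.I • D ⟨p.src, p.ν⟩) * star ((GaugeField.plaqHol W p : Matrix.specialUnitaryGroup (Fin 2) ℂ) : Matrix (Fin 2) (Fin 2) ℂ)))‖ ^ 2)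
                  + (∑ x : Site (F.P K) 0, ∑ j : Fin 2, ∑ k : Fin 2,
            ‖(divB (torusT (F.P K) 0) (fun κ z => unitsField (toUField W) ⟨z, κ⟩) (fun κ z => Complex.I • D ⟨z, κ⟩) x) j k‖ ^ 2))) :
    ∀ (L : ℕ), 1 < L → ∀ (B₃ : ℝ), 4 < B₃ →
    ∃ e₅ a₁'' : ℝ, 0 < e₅ ∧ 0 < a₁'' ∧ ∀ (i : Idx L) (e ε₁ : ℝ) (V : GaugeField (i.1.1.P i.1.2.1) 0 (Matrix.specialUnitaryGroup (Fin 2) ℂ))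
      (U₀ W : GaugeField (i.1.1.P i.1.2.2) 0 (Matrix.specialUnitaryGroup (Fin 2) ℂ)),
      0 < ε₁ → ε₁ ≤ a₁'' → PlaqSmall ε₁ V → (L : ℝ) ^ 3 * B₃ * ε₁ ≤ e → e ≤ e₅ →
      RegPr i.1.1 i.1.2.1 i.1.2.2 ((L : ℝ) ^ 3 * B₃ * ε₁) U₀ → CloseAvg i.1.1 i.1.2.1 i.1.2.2 i.2.2.le ((L : ℝ) ^ 3 * ε₁) V U₀ →
      W ∈ regFibrePr i.1.1 i.1.2.1 i.1.2.2 i.2.2.le e V → IsCritR2 i.1.1 i.1.2.1 i.1.2.2 i.2.2.le V W →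
        IsMinOn (fun W' : GaugeField (i.1.1.P i.1.2.2) 0 (Matrix.specialUnitaryGroup (Fin 2) ℂ) => wilsonAction4 W')
          (regFibrePr i.1.1 i.1.2.1 i.1.2.2 i.2.2.le e V) W := by
  intro L hL B₃ hB₃
  obtain ⟨e₆, s₀, ζ, δ₀, C₁, C₂, he₆, he₆L, hs₀, hs₀4, hs₀L, hζ, hδ₀, hC₁, hC₂, hC₂e, hsmall, H⟩ := hrowsU L hL
  refine ⟨e₆, 1, he₆, one_pos, ?_⟩
  intro i e ε₁ V U₀ W hε₁ _hε₁a _hV hlo hhi _hRU₀ _hclose hW hWcrit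
  obtain ⟨⟨F, n, K⟩, hF, hnK⟩ := i
  have hL0 : (0 : ℝ) < (L : ℝ) := by exact_mod_cast (show 0 < L by omega)
  have he0 : 0 < e := lt_of_lt_of_le (by positivity) hlo
  have hFL : (F.L : ℝ) = (L : ℝ) := by exact_mod_cast hF
  have hL1 : (1 : ℝ) ≤ (F.L : ℝ) := by have := F.hL.2; exact_mod_cast (by omega : 1 ≤ F.L)
  set ℓ : ℝ := (F.L : ℝ) ^ (K - n) with hℓ
  have hℓ1 : (1 : ℝ) ≤ ℓ := one_le_pow₀ hL1
  have hℓ0 : (0 : ℝ) < ℓ := by linarith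
  -- the scaled radius `s = s₀ℓ⁻¹ ≤ s₀`: `0 ≤ s`, `4s ≤ 1`, `4·10¹¹L⁹(ℓs) = 4·10¹¹L⁹s₀ ≤ 1`
  have hs0 : 0 ≤ s₀ * ℓ⁻¹ := by positivity
  have hs4 : 4 * (s₀ * ℓ⁻¹) ≤ 1 := by
    have hi : ℓ⁻¹ ≤ 1 := inv_le_one_of_one_le₀ hℓ1
    nlinarith [mul_le_mul_of_nonneg_left hi hs₀]
  have hsL : 400000000000 * (F.L : ℝ) ^ 9 * (ℓ * (s₀ * ℓ⁻¹)) ≤ 1 := by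
    rw [show ℓ * (s₀ * ℓ⁻¹) = s₀ by field_simp, hFL]
    exact hs₀L
  -- the windows `10¹⁴L⁹e ≤ 1` and `2eC₂(1+ζ) ≤ ⅛` at this member
  have heL : 100000000000000 * (F.L : ℝ) ^ 9 * e ≤ 1 := by
    rw [hFL]
    have : 100000000000000 * (L : ℝ) ^ 9 * e ≤ 100000000000000 * (L : ℝ) ^ 9 * e₆ := mul_le_mul_of_nonneg_left hhi (by positivity)
    exact this.trans he₆L
  have hC₂' : 0 ≤ C₂ * (1 + ζ) := by positivity
  have hθ : 2 * e * (C₂ * (1 + ζ)) ≤ 1 / 8 := by nlinarith [mul_le_mul_of_nonneg_right hhi hC₂']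
  -- the datum smallness scaled by `ℓ⁻²` (`regThreshold(e) = eℓ⁻²`, `C₂ℓ²·(δ₀ℓ⁻²) = C₂δ₀`, `e ≤ e₆`)
  have hsmall' : 15552 * (s₀ * ℓ⁻¹) ^ 2 + 216 * regThreshold F n K e + 2 * e * (C₁ + C₂ * ℓ ^ 2 * (δ₀ * (ℓ ^ 2)⁻¹)) * (ℓ ^ 2)⁻¹
      ≤ (((1 / (128 * (18 + 537600 * (F.L : ℝ) ^ 4))) * (ℓ ^ 2)⁻¹ - δ₀ * (ℓ ^ 2)⁻¹ / 4) / (1 + ζ / 4)) / 8 := by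
    have hthr : regThreshold F n K e = e * (ℓ ^ 2)⁻¹ := by
      unfold regThreshold
      rw [inv_pow, pow_mul', hℓ]
    rw [hthr, hFL]
    have hℓ2 : (0 : ℝ) < (ℓ ^ 2)⁻¹ := by positivity
    have hden : (0 : ℝ) < 1 + ζ / 4 := by linarith
    have hmono : 15552 * s₀ ^ 2 + 216 * e + 2 * e * (C₁ + C₂ * δ₀)
        ≤ (((1 / (128 * (18 + 537600 * (L : ℝ) ^ 4))) - δ₀ / 4) / (1 + ζ / 4)) / 8 := by
      have h1 : 216 * e ≤ 216 * e₆ := by linarith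
      have hcd : 0 ≤ C₁ + C₂ * δ₀ := by positivity
      have h2 : 2 * e * (C₁ + C₂ * δ₀) ≤ 2 * e₆ * (C₁ + C₂ * δ₀) := by nlinarith [mul_le_mul_of_nonneg_right hhi hcd]
      linarith [hsmall]
    have key : 15552 * (s₀ * ℓ⁻¹) ^ 2 + 216 * (e * (ℓ ^ 2)⁻¹) + 2 * e * (C₁ + C₂ * ℓ ^ 2 * (δ₀ * (ℓ ^ 2)⁻¹)) * (ℓ ^ 2)⁻¹
        = (ℓ ^ 2)⁻¹ * (15552 * s₀ ^ 2 + 216 * e + 2 * e * (C₁ + C₂ * δ₀)) := by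
      field_simp
    have key2 : (((1 / (128 * (18 + 537600 * (L : ℝ) ^ 4))) * (ℓ ^ 2)⁻¹ - δ₀ * (ℓ ^ 2)⁻¹ / 4) / (1 + ζ / 4)) / 8
        = (ℓ ^ 2)⁻¹ * ((((1 / (128 * (18 + 537600 * (L : ℝ) ^ 4))) - δ₀ / 4) / (1 + ζ / 4)) / 8) := by
      field_simp
    rw [key, key2]
    exact mul_le_mul_of_nonneg_left hmono hℓ2.le
  -- a recursion family at `W` (zero content) and the rows at it
  obtain ⟨Q, hQ0, hQs⟩ := exists_trueLinIter_family (N := 2) W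
  exact isMinOn_regFibrePr_of_fibreRows_at F hnK.le hζ hC₂ V hWcrit hW heL Q hQ0 hQs
    (H F hF n K hnK e V W he0 hhi hW hWcrit Q hQ0 hQs) hs0 hs4 hsL hθ hsmall'

end Summit.QuantumFields.YangMills.Theorems.Prop7LocMinOfGaugedRows116Text

end
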